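import Literature.IUT.HodgeTheaters.TemperedCoveringsOfProp36
import Literature.IUT.HodgeTheaters.TemperedCoveringsOfProp36NormallyTerminal
import Literature.AnabelianGeometry.SemiGraphs.TemperedCompactInVerticialFinite
import HarnessLib

/-!
# [IUTchI] Prop. 2.1 / 2.2 for the CANONICAL 𝔾-data of a FINITE graph of anabelioids: Thm. 3.7 (iii) discharged

Mochizuki, *Inter-universal Teichmüller theory I*, kurims manuscript (May 2020), §2, Prop. 2.1 / 2.2 p. 45
[cite: Mochizuki2012, Prop 2.1 p.45] (D-0012 claim key; nothing of the series is asserted here), over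
[SemiAnbd] Thm. 3.7 (iii) [cite: MochizukiSemiAnbd2006, Thm 3.7(iii) pp.40-41] ("Since the semi-graphs `𝔾_j`
are all finite", p. 41).  PROOF-ONLY companion (abc-iut L3-t7 gen 4, follow-through of L5-lead RULINGS #26 (6)):
the assembly `TemperedGraphGroupData.prop21_ofProp36_at` / `tp_isCommensurablyTerminal_ofProp36_at` /
`temperedNormallyTerminal_ofProp36_at` (`TemperedCoveringsOfProp36(NormallyTerminal).lean`) for the canonical data `ofProp36` (`Π^tp_𝔾 := π₁^temp(𝒢)`, `Π̂_𝔾 :=` its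
profinite completion) with its hypothesis `hCV : CompactInVerticialAt 𝒢` — [SemiAnbd] Thm. 3.7 (iii) AT `𝒢` —
DISCHARGED for every FINITE underlying semi-graph by abc-iut-L3-t8's
`ProfiniteSemiGraph.compactInVerticialAt_of_finiteGraph` (`TemperedCompactInVerticialFinite.lean`).  REMAINING
hypotheses, verbatim: a family `Λv` of verticial subgroups (`hΛv`; one exists by
`exists_verticialFamily_of_prop36`) and the node data `src/tgt/c₁/c₂` with (A3) = [NodNon] Lem. 1.9 (ii)
(`hA3`).  Typed ≠ discharged; nothing here bears on [IUTchIII] Cor. 3.12.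
-/

noncomputable section

namespace Literature.IUT.HodgeTheaters

open CategoryTheory
open scoped Pointwise
open Literature.AnabelianGeometry.SemiGraphs Literature.AnabelianGeometry.SemiGraphs.ProfiniteSemiGraph
open Literature.AnabelianGeometry.AbsoluteAnabelian (IsCommensurablyTerminal)

universe u

namespace TemperedGraphGroupData

variable (𝒢 : ProfiniteSemiGraph.{u}) (h37 : 𝒢.Thm37Hypotheses)
  (Sigma SigmaHat : Set ℕ) (hsub : Sigma ⊆ SigmaHat) (hne : Sigma.Nonempty)
  (hprime : ∀ p ∈ SigmaHat, p.Prime)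
  (TpH : Subgroup (𝒢.temperedPiChart h37.toProp36Hypotheses).G)
  (HatH : Subgroup
    (exists_completion_of_prop36 𝒢 h37.toProp36Hypotheses (𝒢.temperedPiChart h37.toProp36Hypotheses)).choose)
  (hle : TpH.map
    (exists_completion_of_prop36 𝒢 h37.toProp36Hypotheses
      (𝒢.temperedPiChart h37.toProp36Hypotheses)).choose_spec.choose.toMonoidHom ≤ HatH)

/-- **[IUTchI] Prop. 2.1 for the canonical 𝔾-data `ofProp36` of a FINITE graph of anabelioids**, with `c`,
`e`, `hPC`, `hGal` by name AND Thm. 3.7 (iii) at `𝒢` discharged (`compactInVerticialAt_of_finiteGraph`):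
conditional exactly on a family of verticial subgroups (`Λv`, `hΛv`, in the chart's currency) and the node
data with (A3) (`hA3`). ([IUTchI] Prop 2.1 p.45; [SemiAnbd] Thm 3.7 (iii) p.41 "the semi-graphs `𝔾_j` are all
finite") [claim: Mochizuki2012, status: disputed] -/
theorem prop21_ofProp36_of_finiteGraph [Finite 𝒢.graph.Vertex] [Finite 𝒢.graph.Edge]
    (Λv : 𝒢.graph.Vertex →
      Subgroup (ofProp36 𝒢 h37.toProp36Hypotheses Sigma SigmaHat hsub hne hprime TpH HatH hle).Tp)
    (hΛv : ∀ v, Λv v ∈ verticialSubgroups (𝒢.temperedPiChart h37.toProp36Hypotheses) v)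
    {E : Type*} (src tgt : E → 𝒢.graph.Vertex)
    (c₁ c₂ : E → (ofProp36 𝒢 h37.toProp36Hypotheses Sigma SigmaHat hsub hne hprime TpH HatH hle).Tp)
    (hA3 : letI D := ofProp36 𝒢 h37.toProp36Hypotheses Sigma SigmaHat hsub hne hprime TpH HatH hle
      ∀ (v w : 𝒢.graph.Vertex) (g h : D.Hat),
      MulAut.conj g • (Λv v).map D.ι ⊓ MulAut.conj h • (Λv w).map D.ι ≠ ⊥ →
        (v = w ∧ g⁻¹ * h ∈ (Λv v).map D.ι) ∨
        ∃ (e : E) (k : D.Hat), ∃ p ∈ (Λv (src e)).map D.ι, ∃ q ∈ (Λv (tgt e)).map D.ι,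
          (src e = v ∧ tgt e = w ∧ g = k * D.ι (c₁ e) * p ∧ h = k * D.ι (c₂ e) * q) ∨
          (src e = w ∧ tgt e = v ∧ h = k * D.ι (c₁ e) * p ∧ g = k * D.ι (c₂ e) * q)) :
    (ofProp36 𝒢 h37.toProp36Hypotheses Sigma SigmaHat hsub hne hprime TpH HatH hle).ProfiniteConjugatesOfCompactSubgroups :=
  prop21_ofProp36_at 𝒢 h37 Sigma SigmaHat hsub hne hprime TpH HatH hle
    ProfiniteSemiGraph.compactInVerticialAt_of_finiteGraph Λv hΛv src tgt c₁ c₂ hA3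

/-- **[IUTchI] Prop. 2.2, "in particular `Π^tp_𝔾` is commensurably terminal in `Π̂_𝔾`", for the canonical
𝔾-data `ofProp36` of a FINITE graph of anabelioids**, with `c`, `e`, `hPC`, `hGal`, `hVI` by name AND
Thm. 3.7 (iii) at `𝒢` discharged (`compactInVerticialAt_of_finiteGraph`): conditional exactly on a verticial
family and the node data with (A3). ([IUTchI] Prop 2.2 p.45; [SemiAnbd] Thm 3.7 (iii) p.41)
[claim: Mochizuki2012, status: disputed] -/
theorem tp_isCommensurablyTerminal_ofProp36_of_finiteGraph [Finite 𝒢.graph.Vertex] [Finite 𝒢.graph.Edge]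
    (Λv : 𝒢.graph.Vertex →
      Subgroup (ofProp36 𝒢 h37.toProp36Hypotheses Sigma SigmaHat hsub hne hprime TpH HatH hle).Tp)
    (hΛv : ∀ v, Λv v ∈ verticialSubgroups (𝒢.temperedPiChart h37.toProp36Hypotheses) v)
    {E : Type*} (src tgt : E → 𝒢.graph.Vertex)
    (c₁ c₂ : E → (ofProp36 𝒢 h37.toProp36Hypotheses Sigma SigmaHat hsub hne hprime TpH HatH hle).Tp)
    (hA3 : letI D := ofProp36 𝒢 h37.toProp36Hypotheses Sigma SigmaHat hsub hne hprime TpH HatH hle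
      ∀ (v w : 𝒢.graph.Vertex) (g h : D.Hat),
      MulAut.conj g • (Λv v).map D.ι ⊓ MulAut.conj h • (Λv w).map D.ι ≠ ⊥ →
        (v = w ∧ g⁻¹ * h ∈ (Λv v).map D.ι) ∨
        ∃ (e : E) (k : D.Hat), ∃ p ∈ (Λv (src e)).map D.ι, ∃ q ∈ (Λv (tgt e)).map D.ι,
          (src e = v ∧ tgt e = w ∧ g = k * D.ι (c₁ e) * p ∧ h = k * D.ι (c₂ e) * q) ∨
          (src e = w ∧ tgt e = v ∧ h = k * D.ι (c₁ e) * p ∧ g = k * D.ι (c₂ e) * q)) :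
    IsCommensurablyTerminal
      (ofProp36 𝒢 h37.toProp36Hypotheses Sigma SigmaHat hsub hne hprime TpH HatH hle).ι.range :=
  tp_isCommensurablyTerminal_ofProp36_at 𝒢 h37 Sigma SigmaHat hsub hne hprime TpH HatH hle
    ProfiniteSemiGraph.compactInVerticialAt_of_finiteGraph Λv hΛv src tgt c₁ c₂ hA3

/-- **[IUTchI] Rmk. 2.2.2 for the canonical 𝔾-data `ofProp36` of a FINITE graph of anabelioids: `Π^tp_𝔾` is
normally terminal in `Π̂_𝔾`**, Thm. 3.7 (iii) at `𝒢` discharged (`compactInVerticialAt_of_finiteGraph`):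
conditional exactly on a verticial family and the node data with (A3). ([IUTchI] Rmk 2.2.2 p.46;
[SemiAnbd] Thm 3.7 (iii) p.41) [claim: Mochizuki2012, status: disputed] -/
theorem temperedNormallyTerminal_ofProp36_of_finiteGraph [Finite 𝒢.graph.Vertex] [Finite 𝒢.graph.Edge]
    (Λv : 𝒢.graph.Vertex →
      Subgroup (ofProp36 𝒢 h37.toProp36Hypotheses Sigma SigmaHat hsub hne hprime TpH HatH hle).Tp)
    (hΛv : ∀ v, Λv v ∈ verticialSubgroups (𝒢.temperedPiChart h37.toProp36Hypotheses) v)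
    {E : Type*} (src tgt : E → 𝒢.graph.Vertex)
    (c₁ c₂ : E → (ofProp36 𝒢 h37.toProp36Hypotheses Sigma SigmaHat hsub hne hprime TpH HatH hle).Tp)
    (hA3 : letI D := ofProp36 𝒢 h37.toProp36Hypotheses Sigma SigmaHat hsub hne hprime TpH HatH hle
      ∀ (v w : 𝒢.graph.Vertex) (g h : D.Hat),
      MulAut.conj g • (Λv v).map D.ι ⊓ MulAut.conj h • (Λv w).map D.ι ≠ ⊥ →
        (v = w ∧ g⁻¹ * h ∈ (Λv v).map D.ι) ∨
        ∃ (e : E) (k : D.Hat), ∃ p ∈ (Λv (src e)).map D.ι, ∃ q ∈ (Λv (tgt e)).map D.ι,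
          (src e = v ∧ tgt e = w ∧ g = k * D.ι (c₁ e) * p ∧ h = k * D.ι (c₂ e) * q) ∨
          (src e = w ∧ tgt e = v ∧ h = k * D.ι (c₁ e) * p ∧ g = k * D.ι (c₂ e) * q)) :
    (ofProp36 𝒢 h37.toProp36Hypotheses Sigma SigmaHat hsub hne hprime TpH HatH hle).TemperedNormallyTerminal :=
  temperedNormallyTerminal_ofProp36_at 𝒢 h37 Sigma SigmaHat hsub hne hprime TpH HatH hle
    ProfiniteSemiGraph.compactInVerticialAt_of_finiteGraph Λv hΛv src tgt c₁ c₂ hA3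

end TemperedGraphGroupData

end Literature.IUT.HodgeTheaters

end
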